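import Summits.FinalStateConjecture.FinalStateConjecture.Theorems.EIHFluxBalanceInertialRecessionSlavingTangentData

/-!
# Route EIHFluxBalance — `InertialRecession` (E′), stub `stub_frozenVacuumSlaving` (K1): SECOND partial
# derivatives of the Kerr–Schild radius (general formula; tables at tangent and axis points)

Helper file for the crux `stmt-FinalStateConjecture-17403`. The momentum rows of the slaving stub consume the
`2`-jet of the frozen Kerr–Schild data at the evaluation events. From the closed form of the first partials
`∂_{i+1} r = N_i/D`, `N_i = r² x^{i+1} + δ_{i2} a² x³`, `D = r Σ`, `Σ = 2r² − ‖x̲‖² + a²`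
(`Kerr.fderiv_radius_basisVector_succ`, valid on the open set `{r > 0}`), the quotient rule along coordinate lines
gives `∂_{j+1}∂_{i+1} r = (∂_{j+1}N_i · D − N_i · ∂_{j+1}D)/D²` with `∂_{j+1}N_i = 2r ∂_{j+1}r x^{i+1} + r² δ_{ij} + δ_{i2}δ_{j2} a²`,
`∂_{j+1}D = ∂_{j+1}r Σ + r(4r ∂_{j+1}r − 2x^{j+1})` (`fderiv_fderiv_radius_succ_succ`), and `∂₀∂_{i+1} r = 0`.
Tables: at a tangent point `(t, x, a, 0)`: `∂₁₁r = 0`, `∂₁₂r = −a/x²`, `∂₂₂r = (x² − a²)/x³`, `∂₃₃r = (x² + a²)/x³`,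
`∂₁₃r = ∂₂₃r = 0`; at an axis point `(t, 0, 0, z)`: `∂₁₁r = ∂₂₂r = |z|/(z² + a²)`, all others `0`.
Literature + `…SlavingAxisData/TangentData` only; no definitions, no `sorry`. [folklore]
-/

set_option linter.dupNamespace false

noncomputable section

open scoped Topology
open Filter Set Function Literature.Geometry.Lorentzian Literature.Geometry.Lorentzian.Kerr

namespace Summit.FinalStateConjecture.FinalStateConjecture.Theorems.SublinearIsFree.Slaving

/-- `(if p then c * y else 0) = (if p then c else 0) * y`. [folklore] -/
theorem ite_mul_aux {p : Prop} [Decidable p] (c y : ℝ) : (if p then c * y else 0) = (if p then c else 0) * y := by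
  split_ifs <;> simp

section General

variable {a : ℝ} {x : E4} (hx : 0 < radius a x)
include hx

/-- `x ↦ ∂_v r(x)` is differentiable wherever `r > 0` (`r` is `C²` there). [folklore] -/
theorem differentiableAt_fderiv_radius_apply (v : E4) :
    DifferentiableAt ℝ (fun z ↦ fderiv ℝ (radius a) z v) x := by
  have h2 : ContDiffAt ℝ 2 (radius a) x := contDiffAt_radius hx
  have h1 : ContDiffAt ℝ 1 (fderiv ℝ (radius a)) x :=
    h2.fderiv_right (m := 1) (by norm_num)
  exact ((ContinuousLinearMap.apply ℝ ℝ v).contDiff.contDiffAt.comp x h1).differentiableAt one_ne_zero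

omit hx in
/-- `Σ` in coordinates: `Σ = 2r² − (x₁² + x₂² + x₃²) + a²`. [folklore] -/
theorem blSigma_spatial_eq (z : E4) :
    blSigma a (E4.spatial z) = 2 * radius a z ^ 2 - (z 1 ^ 2 + z 2 ^ 2 + z 3 ^ 2) + a ^ 2 := by
  unfold blSigma
  rw [radius_ofTimeSpace_spatial]
  have : ‖E4.spatial z‖ ^ 2 = z 1 ^ 2 + z 2 ^ 2 + z 3 ^ 2 := E4.spatialNorm_sq z
  rw [this]

omit hx in
/-- The closed form of `∂_{i+1} r` as a function, on `{r > 0}`. [folklore] -/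
theorem fderiv_radius_succ_eq (i : Fin 3) {z : E4} (hz : 0 < radius a z) :
    fderiv ℝ (radius a) z (E4.basisVector i.succ) =
      (radius a z ^ 2 * z i.succ + if i = 2 then a ^ 2 * z 3 else 0) /
        (radius a z * (2 * radius a z ^ 2 - (z 1 ^ 2 + z 2 ^ 2 + z 3 ^ 2) + a ^ 2)) := by
  rw [fderiv_radius_basisVector_succ hz, blSigma_spatial_eq z]

/-- **The second partials of the Kerr–Schild radius** (quotient rule along the coordinate line
`t ↦ x + t ∂_{j+1}` applied to the closed form of `∂_{i+1} r`). With `r = radius a x`, `rⱼ = ∂_{j+1} r`,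
`S = ‖x̲‖²`, `Σ = 2r² − S + a²`, `N = r² x^{i+1} + δ_{i2} a² x³`, `D = rΣ`:
`∂_{j+1}∂_{i+1} r = ((2 r rⱼ x^{i+1} + r² δ_{ij} + δ_{i2}δ_{j2} a²) D − N (rⱼ Σ + r (4 r rⱼ − 2 x^{j+1})))/D²`. [folklore] -/
theorem fderiv_fderiv_radius_succ_succ (i j : Fin 3) :
    fderiv ℝ (fun z ↦ fderiv ℝ (radius a) z (E4.basisVector i.succ)) x (E4.basisVector j.succ) =
      ((2 * radius a x * fderiv ℝ (radius a) x (E4.basisVector j.succ) * x i.succ +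
            radius a x ^ 2 * (if i = j then 1 else 0) + if i = 2 ∧ j = 2 then a ^ 2 else 0) *
          (radius a x * (2 * radius a x ^ 2 - (x 1 ^ 2 + x 2 ^ 2 + x 3 ^ 2) + a ^ 2)) -
        (radius a x ^ 2 * x i.succ + if i = 2 then a ^ 2 * x 3 else 0) *
          (fderiv ℝ (radius a) x (E4.basisVector j.succ) *
              (2 * radius a x ^ 2 - (x 1 ^ 2 + x 2 ^ 2 + x 3 ^ 2) + a ^ 2) +
            radius a x * (4 * radius a x * fderiv ℝ (radius a) x (E4.basisVector j.succ) -
              2 * x j.succ))) /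
      (radius a x * (2 * radius a x ^ 2 - (x 1 ^ 2 + x 2 ^ 2 + x 3 ^ 2) + a ^ 2)) ^ 2 := by
  set v : E4 := E4.basisVector j.succ with hv
  have hd := differentiableAt_fderiv_radius_apply hx (E4.basisVector i.succ)
  refine (hd.hasFDerivAt.hasLineDerivAt v).unique ?_
  show HasDerivAt (fun t : ℝ ↦ fderiv ℝ (radius a) (x + t • v) (E4.basisVector i.succ)) _ 0
  -- the closed form holds along the line near t = 0
  have hopen : IsOpen {z : E4 | 0 < radius a z} := isOpen_lt continuous_const (continuous_radius a)
  have hline : Continuous (fun t : ℝ ↦ x + t • v) := by fun_prop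
  have hev : ∀ᶠ t : ℝ in 𝓝 0, 0 < radius a (x + t • v) := by
    have : (fun t : ℝ ↦ x + t • v) ⁻¹' {z | 0 < radius a z} ∈ 𝓝 (0 : ℝ) :=
      hline.continuousAt.preimage_mem_nhds (hopen.mem_nhds (by simpa using hx))
    exact this
  have hfun : (fun t : ℝ ↦ fderiv ℝ (radius a) (x + t • v) (E4.basisVector i.succ)) =ᶠ[𝓝 0]
      fun t ↦ (radius a (x + t • v) ^ 2 * (x i.succ + t * v i.succ) +
          (if i = 2 then a ^ 2 else 0) * (x 3 + t * v 3)) /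
        (radius a (x + t • v) * (2 * radius a (x + t • v) ^ 2 -
          ((x 1 + t * v 1) ^ 2 + (x 2 + t * v 2) ^ 2 + (x 3 + t * v 3) ^ 2) + a ^ 2)) := by
    filter_upwards [hev] with t ht
    rw [fderiv_radius_succ_eq i ht]
    simp only [add_smul_apply_E4, ite_mul_aux]
  refine HasDerivAt.congr_of_eventuallyEq ?_ hfun
  -- derivative of the closed form along the line
  have hr := hasDerivAt_radius_line hx v
  set r0 := radius a x with hr0
  set rj := fderiv ℝ (radius a) x v with hrj
  have hN : HasDerivAt (fun t : ℝ ↦ radius a (x + t • v) ^ 2 * (x i.succ + t * v i.succ) +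
        (if i = 2 then a ^ 2 else 0) * (x 3 + t * v 3))
      (↑(2 : ℕ) * radius a (x + (0 : ℝ) • v) ^ (2 - 1) * rj * (x i.succ + 0 * v i.succ) +
          radius a (x + (0 : ℝ) • v) ^ 2 * (1 * v i.succ) +
        (if i = 2 then a ^ 2 else 0) * (1 * v 3)) 0 :=
    ((hr.pow 2).mul (((hasDerivAt_id (0 : ℝ)).mul_const (v i.succ)).const_add (x i.succ))).add
      ((((hasDerivAt_id (0 : ℝ)).mul_const (v 3)).const_add (x 3)).const_mul _)
  have hS : HasDerivAt (fun t : ℝ ↦ (x 1 + t * v 1) ^ 2 + (x 2 + t * v 2) ^ 2 + (x 3 + t * v 3) ^ 2)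
      (↑(2 : ℕ) * (x 1 + 0 * v 1) ^ (2 - 1) * (1 * v 1) + ↑(2 : ℕ) * (x 2 + 0 * v 2) ^ (2 - 1) * (1 * v 2) +
        ↑(2 : ℕ) * (x 3 + 0 * v 3) ^ (2 - 1) * (1 * v 3)) 0 :=
    (((((hasDerivAt_id (0 : ℝ)).mul_const (v 1)).const_add (x 1)).pow 2).add
      ((((hasDerivAt_id (0 : ℝ)).mul_const (v 2)).const_add (x 2)).pow 2)).add
      ((((hasDerivAt_id (0 : ℝ)).mul_const (v 3)).const_add (x 3)).pow 2)
  have hD := hr.mul ((((hr.pow 2).const_mul 2).sub hS).add_const (a ^ 2))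
  have hSigpos : 0 < 2 * r0 ^ 2 - (x 1 ^ 2 + x 2 ^ 2 + x 3 ^ 2) + a ^ 2 := by
    have := blSigma_pos (a := a) (y := E4.spatial x) (by rwa [radius_ofTimeSpace_spatial])
    rwa [blSigma_spatial_eq x] at this
  have hD0 : radius a (x + (0 : ℝ) • v) * (2 * radius a (x + (0 : ℝ) • v) ^ 2 -
      ((x 1 + 0 * v 1) ^ 2 + (x 2 + 0 * v 2) ^ 2 + (x 3 + 0 * v 3) ^ 2) + a ^ 2) ≠ 0 := by
    simp only [zero_smul, add_zero, zero_mul]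
    exact mul_ne_zero hx.ne' hSigpos.ne'
  have hdiv := hN.div hD hD0
  refine hdiv.congr_deriv ?_
  simp only [zero_smul, add_zero, zero_mul, Nat.cast_ofNat, one_mul, pow_one, Nat.add_one_sub_one]
  fin_cases i <;> fin_cases j <;> simp [hv, E4.basisVector] <;> ring

end General

/-! ### Tables at tangent and axis points -/

section Tables

variable {a : ℝ} {y : E4}

/-- **Second partials of `r` at a tangent point `(t, x, a, 0)`, `x > 0`:** `∂₁₁r = 0`, `∂₁₂r = −a/x²`,
`∂₂₂r = (x² − a²)/x³`, `∂₃₃r = (x² + a²)/x³`, `∂₁₃r = ∂₂₃r = 0`. [folklore] -/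
theorem tangent_fderiv_fderiv_radius (h2 : y 2 = a) (h3 : y 3 = 0) (hx : 0 < y 1) (i j : Fin 3) :
    fderiv ℝ (fun z ↦ fderiv ℝ (radius a) z (E4.basisVector i.succ)) y (E4.basisVector j.succ) =
      ![![0, -(a / y 1 ^ 2), 0],
        ![-(a / y 1 ^ 2), (y 1 ^ 2 - a ^ 2) / y 1 ^ 3, 0],
        ![0, 0, (y 1 ^ 2 + a ^ 2) / y 1 ^ 3]] i j := by
  have hr0 := tangent_radius_pos h2 h3 hx
  have hr := tangent_radius h2 h3 hx
  have hdr := tangent_fderiv_radius h2 h3 hx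
  have hx0 : y 1 ≠ 0 := hx.ne'
  have hS : 2 * y 1 ^ 2 - (y 1 ^ 2 + a ^ 2) + a ^ 2 = y 1 ^ 2 := by ring
  rw [fderiv_fderiv_radius_succ_succ hr0 i j]
  fin_cases i <;> fin_cases j
  · simp [hr, hdr, h2, h3, hS]; left; ring
  · simp [hr, hdr, h2, h3, hS]; field_simp; ring
  · simp [hr, hdr, h2, h3, hS]
  · simp [hr, hdr, h2, h3, hS]; field_simp; ring
  · simp [hr, hdr, h2, h3, hS]; field_simp; ring
  · simp [hr, hdr, h2, h3, hS]
  · simp [hr, hdr, h2, h3, hS]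
  · simp [hr, hdr, h2, h3, hS]
  · simp [hr, hdr, h2, h3, hS]; field_simp

/-- **Second partials of `r` at an axis point `(t, 0, 0, z)`, `z ≠ 0`:** `∂₁₁r = ∂₂₂r = |z|/(z² + a²)`, all other
second partials vanish. [folklore] -/
theorem axis_fderiv_fderiv_radius (h1 : y 1 = 0) (h2 : y 2 = 0) (hz : y 3 ≠ 0) (i j : Fin 3) :
    fderiv ℝ (fun z ↦ fderiv ℝ (radius a) z (E4.basisVector i.succ)) y (E4.basisVector j.succ) =
      ![![|y 3| / (y 3 ^ 2 + a ^ 2), 0, 0],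
        ![0, |y 3| / (y 3 ^ 2 + a ^ 2), 0],
        ![0, 0, 0]] i j := by
  have hr0 := axis_radius_pos (a := a) h1 h2 hz
  have hr := axis_radius (a := a) h1 h2
  have hdr := axis_fderiv_radius (a := a) h1 h2 hz
  have hD : y 3 ^ 2 + a ^ 2 ≠ 0 := by positivity
  have hS : 2 * y 3 ^ 2 - y 3 ^ 2 + a ^ 2 = y 3 ^ 2 + a ^ 2 := by ring
  rw [fderiv_fderiv_radius_succ_succ hr0 i j]
  rcases lt_or_gt_of_ne hz with hneg | hpos
  · have habs : |y 3| = -y 3 := abs_of_neg hneg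
    have hone : y 3 / |y 3| = -1 := by rw [habs, div_neg, div_self hz]
    have hz' : -y 3 ≠ 0 := neg_ne_zero.2 hz
    simp only [hone] at hdr
    fin_cases i <;> fin_cases j
    · simp [hr, hdr, h1, h2, habs, hS]; field_simp
    · simp [hr, hdr, h1, h2, habs, hS]
    · simp [hr, hdr, h1, h2, habs, hS]
    · simp [hr, hdr, h1, h2, habs, hS]
    · simp [hr, hdr, h1, h2, habs, hS]; field_simp
    · simp [hr, hdr, h1, h2, habs, hS]
    · simp [hr, hdr, h1, h2, habs, hS]
    · simp [hr, hdr, h1, h2, habs, hS]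
    · simp [hr, hdr, h1, h2, habs, hS]; left; ring
  · have habs : |y 3| = y 3 := abs_of_pos hpos
    have hone : y 3 / |y 3| = 1 := by rw [habs, div_self hz]
    simp only [hone] at hdr
    fin_cases i <;> fin_cases j
    · simp [hr, hdr, h1, h2, habs, hS]; field_simp
    · simp [hr, hdr, h1, h2, habs, hS]
    · simp [hr, hdr, h1, h2, habs, hS]
    · simp [hr, hdr, h1, h2, habs, hS]
    · simp [hr, hdr, h1, h2, habs, hS]; field_simp
    · simp [hr, hdr, h1, h2, habs, hS]
    · simp [hr, hdr, h1, h2, habs, hS]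
    · simp [hr, hdr, h1, h2, habs, hS]
    · simp [hr, hdr, h1, h2, habs, hS]; left; ring

end Tables

/-- Registered carrier `slaving_radiusHessian_slaving12` of the crux item (= `tangent_fderiv_fderiv_radius`). [folklore] -/
theorem slaving_radiusHessian_slaving12 : open Literature.Geometry.Lorentzian in ∀ {a : ℝ} {y : E4}, y 2 = a → y 3 = 0 → 0 < y 1 → ∀ i j : Fin 3, fderiv ℝ (fun z ↦ fderiv ℝ (Kerr.radius a) z (E4.basisVector i.succ)) y (E4.basisVector j.succ) = ![![0, -(a / y 1 ^ 2), 0], ![-(a / y 1 ^ 2), (y 1 ^ 2 - a ^ 2) / y 1 ^ 3, 0], ![0, 0, (y 1 ^ 2 + a ^ 2) / y 1 ^ 3]] i j :=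
  fun h2 h3 hx i j ↦ tangent_fderiv_fderiv_radius h2 h3 hx i j

end Summit.FinalStateConjecture.FinalStateConjecture.Theorems.SublinearIsFree.Slaving
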